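import Literature.Geometry.DiscreteGeometry.KerteszNinePointsHemisphereHolds
import HarnessLib

/-!
# The top-ball row of the `W = √(2/3)` certificate at its TIGHT case: nine partners (Kertész)
# (crux `NoReconstructionGain`, stmt-Ventures-19144, line `replication-exactness`, inside `stub_noCriminal`)

HONEST FRAMING. Part of the venture `Summits/Ventures/Crystal3D` (cell `crystal3d-full`), helper `--supports` the
crux `NoReconstructionGain` (stmt-Ventures-19144, route `route-Ventures-StickyWulffConstant`), lead wulff-p1 g24.
A PARTIAL ROW of the pointwise ("weighted kissing") certificate for height-confined `(111)` films; not a film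
theorem, not a resolution of the crux.

Context (`…NoReconstructionGainHollowLoad`, this lead): the bilayer-hollow class «no `(111)` criminal below height
`(k+2)√(2/3)`» follows from `ConfinedCodeBoundPhys √(2/3) g` for the clipped linear ramp
`g z = min 2 (max 0 (1 − z/√(2/3)))` by p718884's reduction.  Its offset-`0` (hollow-ball) row is
`hollowRow_ramp`.  This file treats the opposite end, the offset `a = −√(2/3)` (TOP-BALL) row: the ball sits at
height `(k+2)√(2/3)`, it has no plugs (plug directions would have third coordinate `−2√(2/3) < −1`), and all its
partners lie in the closed LOWER hemisphere at depth `≤ c := √(2/3)`, where the ramp weighs `1 + |u₂|/c ∈ [1, 2]`.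
The row `Σ g ≤ 12` is TIGHT at Kertész's nine-point code (the close-packed top ball: a hexagon on the equator, weight
`1` each, and the hollow triple at depth `c`, weight `2` each).

* `topRow_ramp_of_card_ne` — **the top-ball row for every partner count EXCEPT `7` and `8`**: by G. Fejes Tóth's
  `B(3) = 9` (`card_le_nine_of_unit_normal`) there are at most nine partners; if at most six, each weighs `≤ 2`;
  if nine, Kertész's theorem (`kertesz1994_ninePointsHemisphere_holds`, standard axioms since p751552) puts six
  of them ON the equator (weight exactly `1`), so the weight is `≤ 6·1 + 3·2 = 12`.

WHAT IS LEFT of the `W = √(2/3)` window after this file and `hollowRow_ramp`: the top-ball row for `7` and `8`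
partners (slack cases: `Σ |u₂| ≤ 5c`, resp. `≤ 4c`, numerically `≤ 3.7c`, cell memo HOLLOW-g24 §2) and the middle
offsets `a ∈ (−c, 0)` (numerical slack `≥ 0.8` of `6`) — all NON-tight, i.e. certificate-shaped (branch and bound
in the `KerteszCert` currency); none of them is claimed here.  Rung F-C1 not moved.
-/

noncomputable section

namespace Summit.Ventures.Crystal3D.Theorems

open Finset Real
open scoped InnerProductSpace

/-- The third coordinate is the `e₃`-height (local copy). -/
private theorem inner_e3_top (v : EuclideanSpace ℝ (Fin 3)) :
    ⟪EuclideanSpace.single 2 (1 : ℝ), v⟫_ℝ = v 2 := by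
  rw [real_inner_comm, EuclideanSpace.inner_single_right]; simp

/-- Unit vectors with inner product `≤ 1/2` are at distance `≥ 1`. -/
private theorem one_le_dist_of_inner_le_half {u v : EuclideanSpace ℝ (Fin 3)} (hu : ‖u‖ = 1)
    (hv : ‖v‖ = 1) (h : ⟪u, v⟫_ℝ ≤ 1 / 2) : 1 ≤ dist u v := by
  have h2 : dist u v ^ 2 = 2 - 2 * ⟪u, v⟫_ℝ := by
    rw [dist_eq_norm, norm_sub_sq_real, hu, hv]; ring
  nlinarith [h2, dist_nonneg (x := u) (y := v)]

/-- **The top-ball row of `ConfinedCodeBoundPhys √(2/3) ramp`, partner counts `≠ 7, 8`.**  At the offset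
`a = −√(2/3)` (a film ball at height `(k+2)√(2/3)` over layer `k`, partners confined below that height and above
the hollow height `(k+1)√(2/3)`), a finite `60°`-code `N` each of whose members has third coordinate
`−2√(2/3)` (void) or in `[−√(2/3), 0]` has ramp-weight `Σ (1 + |u₂|/√(2/3)) ≤ 12` provided `|N| ≠ 7, 8`:
`|N| ≤ 9` by `B(3) = 9`; `|N| ≤ 6` is trivial (weights `≤ 2`); `|N| = 9` is Kertész 1994 (six members on the
equator weigh `1`).  The cases `|N| = 7, 8` (slack, certificate-shaped) are NOT treated. -/
theorem topRow_ramp_of_card_ne (N : Finset (EuclideanSpace ℝ (Fin 3))) (h1 : ∀ u ∈ N, ‖u‖ = 1)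
    (h2 : ∀ u ∈ N, ∀ v ∈ N, u ≠ v → ⟪u, v⟫_ℝ ≤ 1 / 2)
    (hwin : ∀ u ∈ N, u 2 = -Real.sqrt (2 / 3) - Real.sqrt (2 / 3) ∨
      (-Real.sqrt (2 / 3) ≤ u 2 ∧ u 2 ≤ -Real.sqrt (2 / 3) + Real.sqrt (2 / 3)))
    (h7 : N.card ≠ 7) (h8 : N.card ≠ 8) :
    ∑ u ∈ N, min 2 (max 0 (1 - u 2 / Real.sqrt (2 / 3))) ≤ 12 := by
  classical
  set c : ℝ := Real.sqrt (2 / 3) with hc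
  have hc2 : c ^ 2 = 2 / 3 := Real.sq_sqrt (by norm_num)
  have hcpos : 0 < c := Real.sqrt_pos.2 (by norm_num)
  have hc1 : 1 < 2 * c := by nlinarith
  -- every member lies in the band `[−c, 0]`
  have hband : ∀ u ∈ N, -c ≤ u 2 ∧ u 2 ≤ 0 := by
    intro u hu
    rcases hwin u hu with h | h
    · exfalso
      have habs : |u 2| ≤ 1 := by
        have := abs_real_inner_le_norm (EuclideanSpace.single 2 (1 : ℝ)) u
        rw [inner_e3_top, PiLp.norm_single, norm_one, one_mul, h1 u hu] at this
        exact this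
      rw [h, abs_le] at habs
      linarith [habs.1]
    · exact ⟨h.1, by linarith [h.2]⟩
  -- the ramp on the band: `g = 1 − u₂/c ∈ [1, 2]`
  have hg : ∀ u ∈ N, min 2 (max 0 (1 - u 2 / c)) = 1 - u 2 / c := by
    intro u hu
    have h := hband u hu
    have hlo : 0 ≤ 1 - u 2 / c := by
      have : u 2 / c ≤ 0 := div_nonpos_of_nonpos_of_nonneg h.2 hcpos.le
      linarith
    have hhi : 1 - u 2 / c ≤ 2 := by
      have : -1 ≤ u 2 / c := by rw [le_div_iff₀ hcpos]; linarith [h.1]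
      linarith
    rw [max_eq_right hlo, min_eq_right hhi]
  have hg2 : ∀ u ∈ N, 1 - u 2 / c ≤ 2 := by
    intro u hu
    have : -1 ≤ u 2 / c := by rw [le_div_iff₀ hcpos]; linarith [(hband u hu).1]
    linarith
  rw [Finset.sum_congr rfl hg]
  -- the south pole `e = −e₃`: all members in its closed hemisphere
  set e : EuclideanSpace ℝ (Fin 3) := -EuclideanSpace.single 2 (1 : ℝ) with he
  have hen : ‖e‖ = 1 := by rw [he, norm_neg, PiLp.norm_single, norm_one]
  have hein : ∀ v : EuclideanSpace ℝ (Fin 3), ⟪e, v⟫_ℝ = -v 2 := by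
    intro v; rw [he, inner_neg_left, inner_e3_top]
  have hhemi : ∀ v ∈ N, 0 ≤ ⟪e, v⟫_ℝ := fun v hv => by rw [hein]; linarith [(hband v hv).2]
  have hsep : ∀ v ∈ N, ∀ w ∈ N, v ≠ w → 1 ≤ dist v w :=
    fun v hv w hw hvw => one_le_dist_of_inner_le_half (h1 v hv) (h1 w hw) (h2 v hv w hw hvw)
  have h9 : N.card ≤ 9 := Literature.Geometry.DiscreteGeometry.card_le_nine_of_unit_normal hen h1 hhemi hsep
  by_cases hsmall : N.card ≤ 6
  · -- at most six partners, each of weight `≤ 2`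
    calc ∑ u ∈ N, (1 - u 2 / c) ≤ ∑ u ∈ N, (2 : ℝ) := Finset.sum_le_sum hg2
      _ = 2 * N.card := by rw [sum_const, nsmul_eq_mul, mul_comm]
      _ ≤ 12 := by
        have : (N.card : ℝ) ≤ 6 := by exact_mod_cast hsmall
        linarith
  · -- nine partners: Kertész puts six on the equator
    have hN9 : N.card = 9 := by omega
    have hK := Literature.Geometry.DiscreteGeometry.kertesz1994_ninePointsHemisphere_holds e hen N h1
      hhemi hsep hN9
    set K := N.filter (fun v => ⟪e, v⟫_ℝ = 0) with hKdef
    have hKN : K ⊆ N := filter_subset _ _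
    have hKz : ∀ v ∈ K, v 2 = 0 := by
      intro v hv
      have := (mem_filter.1 hv).2
      rw [hein] at this; linarith
    rw [← sum_sdiff hKN]
    have hA : ∑ u ∈ N \ K, (1 - u 2 / c) ≤ 2 * ((N \ K).card : ℝ) := by
      calc ∑ u ∈ N \ K, (1 - u 2 / c) ≤ ∑ u ∈ N \ K, (2 : ℝ) :=
            Finset.sum_le_sum fun u hu => hg2 u (sdiff_subset hu)
        _ = 2 * ((N \ K).card : ℝ) := by rw [sum_const, nsmul_eq_mul, mul_comm]
    have hB : ∑ u ∈ K, (1 - u 2 / c) = (K.card : ℝ) := by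
      rw [Finset.sum_congr rfl fun u hu => by rw [hKz u hu, zero_div, sub_zero], sum_const, nsmul_eq_mul,
        mul_one]
    have hcardK : ((N \ K).card : ℝ) = N.card - K.card := by
      rw [card_sdiff_of_subset hKN, Nat.cast_sub (card_le_card hKN)]
    have hK6 : (6 : ℝ) ≤ K.card := by exact_mod_cast hK
    have hN9' : (N.card : ℝ) = 9 := by exact_mod_cast hN9
    rw [hB]
    linarith [hA, hcardK]

end Summit.Ventures.Crystal3D.Theorems

end
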